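import Mathlib
import Summits.Ventures.PercRepro2.HCov
import Summits.Ventures.PercRepro2.A3Coincidence
import Summits.Ventures.PercRepro2.DiagBA3
import Summits.Ventures.PercRepro2.EdgeCubic
import Summits.Ventures.PercRepro2.EdgeCubicAll
import Summits.Ventures.PercRepro2.RootEdgeBernSwap
import Summits.Ventures.PercRepro2.CPolarA3

/-!
# Row 2′CPOLAR is needed only at the edges of a MARK-FREE `a₃`-cluster (blind cell PercRepro2,
p5 g15; `proofs/P5-OEDGE.md` §14)

CPolarA3.lean pins only the fractional edges touching the pinned-open reach `K(p)` of `a₃`. Here the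
induction also STOPS as soon as a mark enters `K(p)` — on every configuration of positive weight that
mark is then joined to `a₃`, and (HCOV) holds outright:

* a root in `K(p)`: `PD` is null and `Gc = 0` (`CPolarA3.Gc_eq_zero_of_root`);
* `o ∈ K(p)`: every `o`-mass of `Gc` equals the corresponding `a₃`-mass (`prob_inter_conn_eq`,
  `prob_inter_conn_inter_eq`), so `Gc = Gc(o := a₃) = 0` (`Gc_eq_zero_of_o_joined`, by
  `A3Coincidence.Gc_a3_eq_o`);
* `b ∈ K(p)`: every `b`-mass equals the `a₃`-mass, so `Gc = Gc(b := a₃) ≥ 0`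
  (`Gc_eq_diag_of_b_joined`, `HCov_of_b_joined`, by `DiagBA3.HCov_diag3` — the two BHK blocks of
  the diagonal).

Hence **`HCov_of_bern_a3_free`** and **`HCov_all_of_cpolarA3Free_all : CPolarA3Free_all R → HCov_all R`**:
the Bernstein positivity `0 ≤ B1 ∧ 0 ≤ B2` is consumed only at the fractional non-root edges
touching a pinned-open reach of `a₃` that contains NONE of `o, a₁, a₂, b` — in graph language, at the
edges of `a₃` in the instances whose five marks stay distinct after contracting the weight-`1` edges.
The null-set primitive is `prob_congr_of_weight`: two events agreeing on every configuration of
positive weight have the same probability.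
-/

namespace Summit.Ventures.PercRepro2

open UnionCluster

namespace CovForm

namespace CPolarA3

/-! ## Events agreeing off a null set -/

section Congr

variable {V : Type*} {E : Type*} [Fintype E] [DecidableEq E] [DecidableEq V] {R : Type*}
  [Field R] [LinearOrder R]

omit [DecidableEq V] [LinearOrder R] in
/-- Two events agreeing on every configuration of positive weight have the same probability. -/
lemma prob_congr_of_weight (p : E → R) (X Y : Set (Config E))
    (h : ∀ ω, weight p ω ≠ 0 → (ω ∈ X ↔ ω ∈ Y)) : prob p X = prob p Y := by
  unfold prob
  refine Finset.sum_congr rfl fun ω _ => ?_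
  by_cases hw : weight p ω = 0
  · by_cases hX : ω ∈ X <;> by_cases hY : ω ∈ Y <;>
      simp [hX, hY, hw]
  · have := h ω hw
    by_cases hX : ω ∈ X
    · rw [Set.indicator_of_mem hX, Set.indicator_of_mem (this.1 hX)]
    · rw [Set.indicator_of_notMem hX, Set.indicator_of_notMem (fun hY => hX (this.2 hY))]

variable {p : E → R} {ends : E → Sym2 V} {a₃ m : V}

omit [DecidableEq V] [LinearOrder R] in
/-- With `m` almost surely joined to `a₃`, the mass of `S ∩ {x ↔ m}` is that of `S ∩ {x ↔ a₃}`. -/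
lemma prob_inter_conn_eq (hj : ∀ ω, weight p ω ≠ 0 → Conn ends ω a₃ m) (S : Set (Config E))
    (x : V) : prob p (S ∩ connEvent ends x m) = prob p (S ∩ connEvent ends x a₃) := by
  refine prob_congr_of_weight p _ _ fun ω hw => ?_
  have h3m := hj ω hw
  simp only [Set.mem_inter_iff, mem_connEvent]
  exact ⟨fun ⟨hS, hx⟩ => ⟨hS, conn_trans hx (conn_symm h3m)⟩,
    fun ⟨hS, hx⟩ => ⟨hS, conn_trans hx h3m⟩⟩

omit [DecidableEq V] [LinearOrder R] in
/-- The same with `{x ↔ m}` as the last factor of a nested intersection. -/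
lemma prob_inter_inter_conn_eq (hj : ∀ ω, weight p ω ≠ 0 → Conn ends ω a₃ m)
    (S T : Set (Config E)) (x : V) :
    prob p (S ∩ (T ∩ connEvent ends x m)) = prob p (S ∩ (T ∩ connEvent ends x a₃)) := by
  refine prob_congr_of_weight p _ _ fun ω hw => ?_
  have h3m := hj ω hw
  simp only [Set.mem_inter_iff, mem_connEvent]
  exact ⟨fun ⟨hS, hT, hx⟩ => ⟨hS, hT, conn_trans hx (conn_symm h3m)⟩,
    fun ⟨hS, hT, hx⟩ => ⟨hS, hT, conn_trans hx h3m⟩⟩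

omit [DecidableEq V] [LinearOrder R] in
/-- The same with `{x ↔ m}` as the first factor of a nested intersection. -/
lemma prob_inter_conn_inter_eq (hj : ∀ ω, weight p ω ≠ 0 → Conn ends ω a₃ m)
    (S T : Set (Config E)) (x : V) :
    prob p (S ∩ (connEvent ends x m ∩ T)) = prob p (S ∩ (connEvent ends x a₃ ∩ T)) := by
  refine prob_congr_of_weight p _ _ fun ω hw => ?_
  have h3m := hj ω hw
  simp only [Set.mem_inter_iff, mem_connEvent]
  exact ⟨fun ⟨hS, hx, hT⟩ => ⟨hS, conn_trans hx (conn_symm h3m), hT⟩,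
    fun ⟨hS, hx, hT⟩ => ⟨hS, conn_trans hx h3m, hT⟩⟩

end Congr

/-! ## A mark joined to `a₃` almost surely -/

section Marks

variable {V : Type*} {E : Type*} [Fintype V] [DecidableEq V] [Fintype E] [DecidableEq E]
  {R : Type*} [Field R] [LinearOrder R] [IsStrictOrderedRing R]

variable {p : E → R} {ends : E → Sym2 V}

omit [Fintype V] [DecidableEq V] in
/-- **`Gc` collapses onto the diagonal `b = a₃`** when `b` is almost surely joined to `a₃`. -/
theorem Gc_eq_diag_of_b_joined {o a₁ a₂ a₃ b : V}
    (hj : ∀ ω, weight p ω ≠ 0 → Conn ends ω a₃ b) :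
    Gc p ends o a₁ a₂ a₃ b = Gc p ends o a₁ a₂ a₃ a₃ := by
  unfold Gc DEF EQbo EQb3 EQb3o EQo EQ3 EQ3o PDb PDbo Do
  rw [gap_eq_Q, gap_eq_Q]
  simp only [prob_inter_conn_eq hj, prob_inter_inter_conn_eq hj]

/-- **(HCOV) when `b` is almost surely joined to `a₃`** (the diagonal theorem `DiagBA3.HCov_diag3`). -/
theorem HCov_of_b_joined (hp : IsProbVec p) {o a₁ a₂ a₃ b : V}
    (hj : ∀ ω, weight p ω ≠ 0 → Conn ends ω a₃ b) : HCov p ends o a₁ a₂ a₃ b := by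
  unfold HCov
  rw [Gc_eq_diag_of_b_joined hj]
  exact DiagBA3.HCov_diag3 p hp ends o a₁ a₂ a₃

omit [Fintype V] [DecidableEq V] in
/-- **`Gc = 0` when `o` is almost surely joined to `a₃`** (`A3Coincidence.Gc_a3_eq_o` after
replacing every `o`-mass by the `a₃`-mass). -/
theorem Gc_eq_zero_of_o_joined {o a₁ a₂ a₃ b : V}
    (hj : ∀ ω, weight p ω ≠ 0 → Conn ends ω a₃ o) :
    Gc p ends o a₁ a₂ a₃ b = 0 := by
  have key : Gc p ends o a₁ a₂ a₃ b = Gc p ends a₃ a₁ a₂ a₃ b := by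
    unfold Gc DEF EQbo EQb3 EQb3o EQo EQ3 EQ3o PDb PDbo Do
    rw [gap_eq_Q]
    simp only [prob_inter_conn_eq hj, prob_inter_conn_inter_eq hj]
  rw [key]
  exact A3Coincidence.Gc_a3_eq_o p ends a₃ a₁ a₂ b

omit [Fintype V] [DecidableEq V] in
/-- (HCOV) when `o` is almost surely joined to `a₃`. -/
theorem HCov_of_o_joined {o a₁ a₂ a₃ b : V}
    (hj : ∀ ω, weight p ω ≠ 0 → Conn ends ω a₃ o) : HCov p ends o a₁ a₂ a₃ b := by
  unfold HCov
  rw [Gc_eq_zero_of_o_joined hj]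

omit [Fintype V] [DecidableEq V] [IsStrictOrderedRing R] in
/-- (HCOV) when a root is almost surely joined to `a₃`. -/
theorem HCov_of_root_joined {o a₁ a₂ a₃ b : V}
    (hj : ∀ ω, weight p ω ≠ 0 → Conn ends ω a₃ a₁ ∨ Conn ends ω a₃ a₂) :
    HCov p ends o a₁ a₂ a₃ b := by
  unfold HCov
  rw [Gc_eq_zero_of_root o b hj]

/-- **(HCOV) when a mark lies in the pinned-open reach of `a₃`.** -/
theorem HCov_of_mark_mem_pinnedReach (hp : IsProbVec p) {o a₁ a₂ a₃ b : V}
    (h : a₁ ∈ pinnedReach p ends a₃ ∨ a₂ ∈ pinnedReach p ends a₃ ∨ o ∈ pinnedReach p ends a₃ ∨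
      b ∈ pinnedReach p ends a₃) : HCov p ends o a₁ a₂ a₃ b := by
  rcases h with h | h | h | h
  · exact HCov_of_root_joined fun ω hw => Or.inl (conn_of_mem_pinnedReach hw h)
  · exact HCov_of_root_joined fun ω hw => Or.inr (conn_of_mem_pinnedReach hw h)
  · exact HCov_of_o_joined fun ω hw => conn_of_mem_pinnedReach hw h
  · exact HCov_of_b_joined hp fun ω hw => conn_of_mem_pinnedReach hw h

end Marks

/-! ## The induction that stops at the marks -/

section Induction

variable {V : Type*} {E : Type*} [Fintype V] [DecidableEq V] [Fintype E] [DecidableEq E]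
  {R : Type*} [Field R] [LinearOrder R] [IsStrictOrderedRing R]

open EdgeLine

/-- The pinned-open reach of `a₃` contains none of the marks `o, a₁, a₂, b`. -/
def MarkFree (p : E → R) (ends : E → Sym2 V) (o a₁ a₂ a₃ b : V) : Prop :=
  a₁ ∉ pinnedReach p ends a₃ ∧ a₂ ∉ pinnedReach p ends a₃ ∧ o ∉ pinnedReach p ends a₃ ∧
    b ∉ pinnedReach p ends a₃

/-- **(HCOV) from the one-edge Bernstein positivity at the fractional non-root edges touching a
MARK-FREE pinned-open reach of `a₃`**: the induction of `HCov_of_bern_a3_nonroot` stopped as soon as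
a mark enters the reach (`HCov_of_mark_mem_pinnedReach`). -/
theorem HCov_of_bern_a3_free (ends : E → Sym2 V) (o a₁ a₂ a₃ b : V)
    (hB : ∀ q : E → R, IsProbVec q → MarkFree q ends o a₁ a₂ a₃ b → ∀ e, q e ≠ 0 → q e ≠ 1 →
      TouchesReach q ends a₃ e → ¬ RootEdge.IsRootEdge ends a₁ a₂ a₃ e →
      0 ≤ B1 q ends o a₁ a₂ a₃ b e ∧ 0 ≤ B2 q ends o a₁ a₂ a₃ b e)
    (p : E → R) (hp : IsProbVec p) : HCov p ends o a₁ a₂ a₃ b := by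
  generalize hn : (fracEdges p).card = n
  induction n using Nat.strong_induction_on generalizing p with
  | _ n ih =>
    by_cases hm : a₁ ∈ pinnedReach p ends a₃ ∨ a₂ ∈ pinnedReach p ends a₃ ∨
        o ∈ pinnedReach p ends a₃ ∨ b ∈ pinnedReach p ends a₃
    · exact HCov_of_mark_mem_pinnedReach hp hm
    · have hfree : MarkFree p ends o a₁ a₂ a₃ b := by
        simp only [not_or] at hm
        exact ⟨hm.1, hm.2.1, hm.2.2.1, hm.2.2.2⟩
      by_cases h : ∃ e ∈ fracEdges p, TouchesReach p ends a₃ e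
      · obtain ⟨e, he, ht⟩ := h
        have hlt : ((fracEdges p).erase e).card < n := by
          rw [← hn]; exact Finset.card_erase_lt_of_mem he
        have hp₀ : IsProbVec (Function.update p e 0) := hp.update e le_rfl zero_le_one
        have hp₁ : IsProbVec (Function.update p e 1) := hp.update e zero_le_one le_rfl
        have h₀ : HCov (Function.update p e 0) ends o a₁ a₂ a₃ b :=
          ih _ hlt (Function.update p e 0) hp₀ (by rw [fracEdges_update p e 0 (Or.inl rfl)])
        have h₁ : HCov (Function.update p e 1) ends o a₁ a₂ a₃ b :=
          ih _ hlt (Function.update p e 1) hp₁ (by rw [fracEdges_update p e 1 (Or.inr rfl)])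
        have hfe : p e ≠ 0 ∧ p e ≠ 1 := by simpa [fracEdges] using he
        by_cases hr : RootEdge.IsRootEdge ends a₁ a₂ a₃ e
        · exact HCov_of_update_zero_of_bern p hp ends o a₁ a₂ a₃ b e h₀ h₁
            (RootEdge.B1_nonneg_of_isRootEdge p hp ends o a₁ a₂ a₃ b e hr h₀)
            (RootEdge.B2_nonneg_of_isRootEdge p hp ends o a₁ a₂ a₃ b e hr)
        · exact HCov_of_update_zero_of_bern p hp ends o a₁ a₂ a₃ b e h₀ h₁
            (hB p hp hfree e hfe.1 hfe.2 ht hr).1 (hB p hp hfree e hfe.1 hfe.2 ht hr).2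
      · simp only [not_exists, not_and] at h
        exact HCov_of_reach_pinned p hp ends o a₁ a₂ a₃ b h

end Induction

/-! ## Over every finite graph -/

section Closure

variable (R : Type*) [Field R] [LinearOrder R] [IsStrictOrderedRing R]

/-- **Row 2′CPOLAR at the non-root edges of a mark-free `a₃`-cluster**: the binders of `HCov_all`,
`0 ≤ B1 ∧ 0 ≤ B2` at every fractional non-root edge touching the pinned-open reach of `a₃` whenever
that reach contains none of `o, a₁, a₂, b`. -/
def CPolarA3Free_all : Prop :=
  ∀ (V E : Type) [Fintype V] [DecidableEq V] [Fintype E] [DecidableEq E]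
    (ends : E → Sym2 V) (p : E → R), IsProbVec p →
    ∀ o a₁ a₂ a₃ b : V, a₁ ≠ a₂ → a₁ ≠ a₃ → a₂ ≠ a₃ → o ≠ a₁ → o ≠ a₂ → o ≠ a₃ → o ≠ b →
      b ≠ a₁ → b ≠ a₂ → b ≠ a₃ → MarkFree p ends o a₁ a₂ a₃ b →
      ∀ e, p e ≠ 0 → p e ≠ 1 → TouchesReach p ends a₃ e → ¬ RootEdge.IsRootEdge ends a₁ a₂ a₃ e →
        0 ≤ EdgeLine.B1 p ends o a₁ a₂ a₃ b e ∧ 0 ≤ EdgeLine.B2 p ends o a₁ a₂ a₃ b e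

omit [IsStrictOrderedRing R] in
/-- `CPolarA3Free_all` is weaker than `CPolarA3NR_all`. -/
theorem cpolarA3Free_all_of_cpolarA3NR_all (h : CPolarA3NR_all R) : CPolarA3Free_all R := by
  intro V E _ _ _ _ ends p hp o a₁ a₂ a₃ b h1 h2 h3 h4 h5 h6 h7 h8 h9 h10 _ e h0 h1' ht hr
  exact h V E ends p hp o a₁ a₂ a₃ b h1 h2 h3 h4 h5 h6 h7 h8 h9 h10 e h0 h1' ht hr

/-- **Row 2′CPOLAR at the non-root edges of a mark-free `a₃`-cluster implies the crux.** -/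
theorem HCov_all_of_cpolarA3Free_all (h : CPolarA3Free_all R) : HCov_all R := by
  intro V E _ _ _ _ ends p hp o a₁ a₂ a₃ b h1 h2 h3 h4 h5 h6 h7 h8 h9 h10
  exact HCov_of_bern_a3_free ends o a₁ a₂ a₃ b
    (fun q hq hfree e h0 h1' ht hr =>
      h V E ends q hq o a₁ a₂ a₃ b h1 h2 h3 h4 h5 h6 h7 h8 h9 h10 hfree e h0 h1' ht hr) p hp

end Closure

end CPolarA3

end CovForm

end Summit.Ventures.PercRepro2
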